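import Mathlib
import HarnessLib

/-!
# RH-FREE · The convergence argument of Cardon–Roberts' Lemma 3.5: `∏_k (1 − z²/x_{n,k}²) → ∏_k (1 − z²/a_k²)` locally uniformly, from `a_k < x_{n,k}`, `x_{n,k} → a_k` and `Σ 1/a_k² < ∞` — nothing here bears on the truth of RH

Literature-typing tranche `rh-lit-broughan-2` (Broughan, *Equivalents of the Riemann Hypothesis*
Vol. 2, Thm 6.16; Cardon–Roberts 2006, Lemmas 3.3–3.5). Fourth, purely analytic layer of the
proof of the tree's named fact `CardonRoberts2006_lemma_3_5`. Everything here is about an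
abstract "spectrum" `S ⊂ (0,∞)` — infinite, locally finite, `Σ_{a ∈ S} a⁻² < ∞` — and abstract
finite "zero sets" `Z_n ⊂ (0,∞)`:

* `CardonRobertsLimit.exists_strictMono_range_eq` — an infinite set of reals all of whose lower
  sections are finite is the range of a strictly increasing sequence `a_1 < a_2 < ⋯` (CR p. 61:
  "We will label the positive values in `S(F)` as `a_1 < a_2 < a_3 < ⋯`").
* `CardonRobertsLimit.norm_prod_one_add_le`, `norm_prod_one_add_sub_prod_le` — the finite-product
  estimates `|∏(1+w_j)| ≤ e^{Σ M_j}`, `|∏(1+w_j) − ∏(1+w'_j)| ≤ e^{Σ M_j} Σ|w_j − w'_j|`.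
* `CardonRobertsLimit.tendstoUniformlyOn_tprod_one_add` — **dominated convergence for infinite
  products**, the abstract form of CR's `ε/3`-argument on pp. 62–63: if `|u_{n,j}|, |g_j| ≤ M_j`
  on `K` with `Σ M_j < ∞` and `u_{n,j} → g_j` uniformly on `K` for each `j`, then
  `∏_j (1 + u_{n,j}) → ∏_j (1 + g_j)` uniformly on `K`.
* `CardonRobertsLimit.tendsto_index_of_separation` — **CR Lemma 3.4 (`x_{n,k} → a_k`) from
  separation and pointwise vanishing**: if `#{x ∈ Z_n : x ≤ t} ≤ #(S ∩ [0,t))` for all `t`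
  (CR Lemma 3.3) and `∏_{x ∈ Z_n} (1 − a²/x²) → 0` for every `a ∈ S`, then the `k`-th smallest
  element of `Z_n` tends to `a_k`; on the tree's road the second hypothesis comes from the
  `L²`-extremal property and polynomial density instead of CR's moment-problem determinacy.
* `CardonRobertsLimit.tendstoLocallyUniformly_prod` — **CR Lemma 3.5, abstract form**: under the
  same hypotheses `∏_{x ∈ Z_n} (1 − z²/x²) → ∏_{a ∈ S} (1 − z²/a²)` locally uniformly on `ℂ`.

No new definitions, no named facts (D-0026); standard axioms only; nothing here bears on the
truth of RH.

## References

* [CardonRoberts2006] D. A. Cardon, S. A. Roberts, J. Approx. Theory 138 (2006) 54–64, Lemmas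
  3.3–3.5, pp. 61–63.
* [Broughan2017] K. Broughan, *Equivalents of the Riemann Hypothesis* Vol. 2, CUP 2017, Thm 6.16.
-/

noncomputable section

open Filter Topology Complex

namespace Literature.NumberTheory.LFunctions

namespace CardonRobertsLimit

/-! ## §1 Increasing enumeration of a locally finite infinite set of reals -/

/-- An infinite set of reals whose lower sections `S ∩ (−∞, L]` are all finite is enumerated by a
strictly increasing sequence: `S = {a_1 < a_2 < ⋯}` ("We will label the positive values in
`S(F)` as `a_1 < a_2 < a_3 < ⋯`"). [cite: CardonRoberts2006, §3 p. 61] -/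
theorem exists_strictMono_range_eq {S : Set ℝ} (hinf : S.Infinite)
    (hfin : ∀ L : ℝ, (S ∩ Set.Iic L).Finite) :
    ∃ e : ℕ → ℝ, StrictMono e ∧ Set.range e = S := by
  classical
  -- every nonempty subset of `S` has a least element
  have hmin : ∀ A : Set ℝ, A ⊆ S → A.Nonempty → ∃ m ∈ A, ∀ b ∈ A, m ≤ b := by
    intro A hA ⟨a₀, ha₀⟩
    have hfinA : (A ∩ Set.Iic a₀).Finite := (hfin a₀).subset (Set.inter_subset_inter_left _ hA)
    have hne : hfinA.toFinset.Nonempty := ⟨a₀, by simp [ha₀]⟩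
    refine ⟨hfinA.toFinset.min' hne, ?_, fun b hb ↦ ?_⟩
    · have h := hfinA.toFinset.min'_mem hne
      rw [Set.Finite.mem_toFinset] at h
      exact h.1
    · by_cases hba : b ≤ a₀
      · exact Finset.min'_le _ _ (by simp [hb, hba])
      · have h1 : hfinA.toFinset.min' hne ≤ a₀ := Finset.min'_le _ _ (by simp [ha₀])
        linarith [lt_of_not_ge hba]
  -- above every real there are further points of `S`
  have hnext : ∀ t : ℝ, (S ∩ Set.Ioi t).Nonempty := by
    intro t
    by_contra h
    rw [Set.not_nonempty_iff_eq_empty] at h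
    refine hinf ((hfin t).subset fun a ha ↦ ⟨ha, ?_⟩)
    rw [Set.mem_Iic]
    by_contra hat
    rw [not_le] at hat
    have : a ∈ S ∩ Set.Ioi t := ⟨ha, Set.mem_Ioi.2 hat⟩
    rw [h] at this
    exact this
  choose nx hnx_mem hnx_le using fun t ↦ hmin (S ∩ Set.Ioi t) Set.inter_subset_left (hnext t)
  obtain ⟨m0, hm0, hm0le⟩ := hmin S subset_rfl hinf.nonempty
  let e : ℕ → ℝ := fun n ↦ Nat.rec m0 (fun _ t ↦ nx t) n
  have he0 : e 0 = m0 := rfl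
  have hes : ∀ n, e (n + 1) = nx (e n) := fun n ↦ rfl
  have hmem : ∀ n, e n ∈ S := by
    intro n
    induction n with
    | zero => exact hm0
    | succ n _ => rw [hes]; exact (hnx_mem (e n)).1
  have hmono : StrictMono e :=
    strictMono_nat_of_lt_succ fun n ↦ by rw [hes]; exact (hnx_mem (e n)).2
  refine ⟨e, hmono, Set.Subset.antisymm (Set.range_subset_iff.2 hmem) fun a ha ↦ ?_⟩
  by_contra hna
  have hlt : ∀ n, e n < a := by
    intro n
    induction n with
    | zero =>
      rw [he0]
      exact lt_of_le_of_ne (hm0le a ha) fun h ↦ hna ⟨0, by rw [he0, h]⟩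
    | succ n ih =>
      have hle : e (n + 1) ≤ a := by rw [hes]; exact hnx_le (e n) a ⟨ha, ih⟩
      exact lt_of_le_of_ne hle fun h ↦ hna ⟨n + 1, h⟩
  have hsub : Set.range e ⊆ S ∩ Set.Iic a := by
    rintro _ ⟨n, rfl⟩
    exact ⟨hmem n, (hlt n).le⟩
  exact Set.infinite_range_of_injective hmono.injective ((hfin a).subset hsub)

/-! ## §2 Finite-product estimates -/

/-- `|∏_{j ∈ s} (1 + w_j)| ≤ exp (Σ_{j ∈ s} |w_j|)`. [cite: CardonRoberts2006, Lemma 3.5 p. 62 (the bound `M_R`)] -/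
theorem norm_prod_one_add_le {ι : Type*} (s : Finset ι) (w : ι → ℂ) :
    ‖∏ j ∈ s, (1 + w j)‖ ≤ Real.exp (∑ j ∈ s, ‖w j‖) := by
  have h := Finset.norm_prod_one_add_sub_one_le s w
  have h2 : ‖∏ j ∈ s, (1 + w j)‖ ≤ ‖∏ j ∈ s, (1 + w j) - 1‖ + ‖(1 : ℂ)‖ := by
    simpa using norm_add_le (∏ j ∈ s, (1 + w j) - 1) (1 : ℂ)
  rw [norm_one] at h2
  linarith

/-- Lipschitz dependence of a finite product on its factors: if `|w_j|, |w'_j| ≤ M_j` on `s` then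
`|∏_{j∈s}(1 + w_j) − ∏_{j∈s}(1 + w'_j)| ≤ e^{Σ_s M_j} · Σ_s |w_j − w'_j|`.
[cite: CardonRoberts2006, Lemma 3.5 pp. 62–63 (the `ε/3` estimate)] -/
theorem norm_prod_one_add_sub_prod_le {ι : Type*} [DecidableEq ι] (s : Finset ι) (w w' : ι → ℂ)
    (M : ι → ℝ) (hw : ∀ j ∈ s, ‖w j‖ ≤ M j) (hw' : ∀ j ∈ s, ‖w' j‖ ≤ M j) :
    ‖∏ j ∈ s, (1 + w j) - ∏ j ∈ s, (1 + w' j)‖ ≤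
      Real.exp (∑ j ∈ s, M j) * ∑ j ∈ s, ‖w j - w' j‖ := by
  induction s using Finset.induction_on with
  | empty => simp
  | insert i s hi ih =>
    have hwi : ‖w i‖ ≤ M i := hw i (Finset.mem_insert_self i s)
    have hw'i : ‖w' i‖ ≤ M i := hw' i (Finset.mem_insert_self i s)
    have hws : ∀ j ∈ s, ‖w j‖ ≤ M j := fun j hj ↦ hw j (Finset.mem_insert_of_mem hj)
    have hw's : ∀ j ∈ s, ‖w' j‖ ≤ M j := fun j hj ↦ hw' j (Finset.mem_insert_of_mem hj)
    have hM0 : 0 ≤ M i := (norm_nonneg _).trans hwi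
    have ih' := ih hws hw's
    set A := ∏ j ∈ s, (1 + w j) with hA
    set B := ∏ j ∈ s, (1 + w' j) with hB
    set T := ∑ j ∈ s, M j with hT
    set D := ∑ j ∈ s, ‖w j - w' j‖ with hD
    rw [Finset.prod_insert hi, Finset.prod_insert hi, Finset.sum_insert hi, Finset.sum_insert hi]
    have hAle : ‖A‖ ≤ Real.exp T := by
      refine (norm_prod_one_add_le s w).trans (Real.exp_le_exp.2 (Finset.sum_le_sum hws))
    have hD0 : 0 ≤ D := Finset.sum_nonneg fun j _ ↦ norm_nonneg _
    have hexpT : 0 ≤ Real.exp T := (Real.exp_pos T).le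
    have h1 : (1 + w i) * A - (1 + w' i) * B = (w i - w' i) * A + (1 + w' i) * (A - B) := by ring
    rw [h1]
    calc ‖(w i - w' i) * A + (1 + w' i) * (A - B)‖
        ≤ ‖w i - w' i‖ * ‖A‖ + ‖1 + w' i‖ * ‖A - B‖ := by
          refine (norm_add_le _ _).trans ?_
          rw [norm_mul, norm_mul]
      _ ≤ ‖w i - w' i‖ * Real.exp T + (1 + M i) * (Real.exp T * D) := by
          gcongr
          · exact (norm_add_le _ _).trans (by rw [norm_one]; gcongr)
      _ ≤ Real.exp (M i + T) * (‖w i - w' i‖ + D) := by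
          rw [Real.exp_add]
          have h3 : 1 + M i ≤ Real.exp (M i) := by linarith [Real.add_one_le_exp (M i)]
          have h4 : 1 ≤ Real.exp (M i) := Real.one_le_exp hM0
          have h5 : 0 ≤ ‖w i - w' i‖ := norm_nonneg _
          nlinarith [mul_nonneg hexpT hD0, mul_nonneg hexpT h5]

/-- Tail of an infinite product: if `|g_j| ≤ M_j` with `Σ M_j < ∞` then
`|∏_j (1 + g_j) − 1| ≤ exp(Σ_j M_j) − 1`. [cite: CardonRoberts2006, Lemma 3.5 pp. 62–63 (the tail factors `1 + α(z)`, `1 + β(z)`)] -/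
theorem norm_tprod_one_add_sub_one_le (g : ℕ → ℂ) (M : ℕ → ℝ) (hM : Summable M)
    (hg : ∀ j, ‖g j‖ ≤ M j) : ‖∏' j, (1 + g j) - 1‖ ≤ Real.exp (∑' j, M j) - 1 := by
  have hgs : Summable fun j ↦ ‖g j‖ := hM.of_nonneg_of_le (fun j ↦ norm_nonneg _) hg
  have hmul : Multipliable fun j ↦ 1 + g j := multipliable_one_add_of_summable hgs
  have hlim : Tendsto (fun N ↦ ‖∏ j ∈ Finset.range N, (1 + g j) - 1‖) atTop
      (𝓝 ‖∏' j, (1 + g j) - 1‖) :=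
    ((hmul.hasProd.tendsto_prod_nat).sub_const 1).norm
  refine le_of_tendsto' hlim fun N ↦ ?_
  refine (Finset.norm_prod_one_add_sub_one_le _ _).trans ?_
  gcongr
  exact (Finset.sum_le_sum fun j _ ↦ hg j).trans
    (hM.sum_le_tsum _ fun j _ ↦ (norm_nonneg _).trans (hg j))

/-! ## §3 Dominated convergence for infinite products -/

/-- **Dominated convergence for infinite products** (the abstract `ε/3`-argument of CR pp. 62–63):
if `|u_{n,j}(x)|, |g_j(x)| ≤ M_j` for `x ∈ K` with `Σ_j M_j < ∞`, and `u_{n,j} → g_j` uniformly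
on `K` for each `j`, then `∏_j (1 + u_{n,j}(x)) → ∏_j (1 + g_j(x))` uniformly on `K`.
[cite: CardonRoberts2006, Lemma 3.5 pp. 62–63] -/
theorem tendstoUniformlyOn_tprod_one_add {X : Type*} {K : Set X} {u : ℕ → ℕ → X → ℂ}
    {g : ℕ → X → ℂ} {M : ℕ → ℝ} (hM : Summable M) (hu : ∀ n j x, x ∈ K → ‖u n j x‖ ≤ M j)
    (hg : ∀ j x, x ∈ K → ‖g j x‖ ≤ M j)
    (hlim : ∀ j, TendstoUniformlyOn (fun n ↦ u n j) (g j) atTop K) :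
    TendstoUniformlyOn (fun n x ↦ ∏' j, (1 + u n j x)) (fun x ↦ ∏' j, (1 + g j x)) atTop K := by
  classical
  rw [Metric.tendstoUniformlyOn_iff]
  intro ε hε
  set T : ℝ := ∑' j, M j with hT
  have hM0 : ∀ j, K.Nonempty → 0 ≤ M j := fun j ⟨x, hx⟩ ↦ (norm_nonneg _).trans (hg j x hx)
  -- choose the splitting index `J` so that the tails are small
  have htail : Tendsto (fun J : ℕ ↦ Real.exp T * (Real.exp (∑' j, M (j + J)) - 1)) atTop (𝓝 0) := by
    have h1 : Tendsto (fun J : ℕ ↦ ∑' j, M (j + J)) atTop (𝓝 0) := tendsto_sum_nat_add M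
    have h2 := ((Real.continuous_exp.tendsto 0).comp h1).sub_const 1
    rw [Function.comp_def, Real.exp_zero, sub_self] at h2
    simpa using h2.const_mul (Real.exp T)
  obtain ⟨J, hJ⟩ := (htail.eventually (gt_mem_nhds (show (0 : ℝ) < ε / 3 by positivity))).exists
  -- heads converge: finitely many uniform limits
  have hε₁ : 0 < ε / (3 * Real.exp T * (J + 1)) := by positivity
  have hhead : ∀ᶠ n in atTop, ∀ j ∈ Finset.range J, ∀ x ∈ K,
      dist (g j x) (u n j x) < ε / (3 * Real.exp T * (J + 1)) := by
    rw [Filter.eventually_all_finset]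
    intro j _
    exact (Metric.tendstoUniformlyOn_iff.1 (hlim j)) _ hε₁
  filter_upwards [hhead] with n hn x hx
  have hM0' : ∀ j, 0 ≤ M j := fun j ↦ hM0 j ⟨x, hx⟩
  have hgs : Summable fun j ↦ ‖g j x‖ := hM.of_nonneg_of_le (fun j ↦ norm_nonneg _) fun j ↦ hg j x hx
  have hus : Summable fun j ↦ ‖u n j x‖ :=
    hM.of_nonneg_of_le (fun j ↦ norm_nonneg _) fun j ↦ hu n j x hx
  have hMtail : Summable fun j ↦ M (j + J) := (summable_nat_add_iff J).2 hM
  have hHg_le : ‖∏ j ∈ Finset.range J, (1 + g j x)‖ ≤ Real.exp T := by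
    refine (norm_prod_one_add_le _ _).trans (Real.exp_le_exp.2 ?_)
    exact (Finset.sum_le_sum fun j _ ↦ hg j x hx).trans (hM.sum_le_tsum _ fun j _ ↦ hM0' j)
  have hHu_le : ‖∏ j ∈ Finset.range J, (1 + u n j x)‖ ≤ Real.exp T := by
    refine (norm_prod_one_add_le _ _).trans (Real.exp_le_exp.2 ?_)
    exact (Finset.sum_le_sum fun j _ ↦ hu n j x hx).trans (hM.sum_le_tsum _ fun j _ ↦ hM0' j)
  have hTg_le : ‖∏' j, (1 + g (j + J) x) - 1‖ ≤ Real.exp (∑' j, M (j + J)) - 1 :=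
    norm_tprod_one_add_sub_one_le (fun j ↦ g (j + J) x) (fun j ↦ M (j + J)) hMtail
      fun j ↦ hg (j + J) x hx
  have hTu_le : ‖∏' j, (1 + u n (j + J) x) - 1‖ ≤ Real.exp (∑' j, M (j + J)) - 1 :=
    norm_tprod_one_add_sub_one_le (fun j ↦ u n (j + J) x) (fun j ↦ M (j + J)) hMtail
      fun j ↦ hu n (j + J) x hx
  -- the three pieces
  have hgm' : Multipliable fun j ↦ 1 + g (j + J) x :=
    multipliable_one_add_of_summable ((summable_nat_add_iff J).2 hgs)
  have hum' : Multipliable fun j ↦ 1 + u n (j + J) x :=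
    multipliable_one_add_of_summable ((summable_nat_add_iff J).2 hus)
  have hPg : ∏' j, (1 + g j x) =
      (∏ j ∈ Finset.range J, (1 + g j x)) * ∏' j, (1 + g (j + J) x) :=
    (Multipliable.prod_mul_tprod_nat_mul' (f := fun j ↦ 1 + g j x) hgm').symm
  have hPu : ∏' j, (1 + u n j x) =
      (∏ j ∈ Finset.range J, (1 + u n j x)) * ∏' j, (1 + u n (j + J) x) :=
    (Multipliable.prod_mul_tprod_nat_mul' (f := fun j ↦ 1 + u n j x) hum').symm
  have hpiece1 : ‖∏' j, (1 + g j x) - ∏ j ∈ Finset.range J, (1 + g j x)‖ ≤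
      Real.exp T * (Real.exp (∑' j, M (j + J)) - 1) := by
    rw [hPg, ← mul_sub_one, norm_mul]
    exact mul_le_mul hHg_le hTg_le (norm_nonneg _) (Real.exp_pos T).le
  have hpiece3 : ‖∏' j, (1 + u n j x) - ∏ j ∈ Finset.range J, (1 + u n j x)‖ ≤
      Real.exp T * (Real.exp (∑' j, M (j + J)) - 1) := by
    rw [hPu, ← mul_sub_one, norm_mul]
    exact mul_le_mul hHu_le hTu_le (norm_nonneg _) (Real.exp_pos T).le
  have hpiece2 : ‖∏ j ∈ Finset.range J, (1 + g j x) - ∏ j ∈ Finset.range J, (1 + u n j x)‖ ≤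
      ε / 3 := by
    have h := norm_prod_one_add_sub_prod_le (Finset.range J) (fun j ↦ g j x) (fun j ↦ u n j x) M
      (fun j _ ↦ hg j x hx) (fun j _ ↦ hu n j x hx)
    refine h.trans ?_
    have hsum_le : ∑ j ∈ Finset.range J, ‖g j x - u n j x‖ ≤
        J * (ε / (3 * Real.exp T * (J + 1))) := by
      have : ∀ j ∈ Finset.range J, ‖g j x - u n j x‖ ≤ ε / (3 * Real.exp T * (J + 1)) :=
        fun j hj ↦ by rw [← dist_eq_norm]; exact (hn j hj x hx).le
      refine (Finset.sum_le_sum this).trans ?_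
      rw [Finset.sum_const, Finset.card_range, nsmul_eq_mul]
    have hexp_le : Real.exp (∑ j ∈ Finset.range J, M j) ≤ Real.exp T :=
      Real.exp_le_exp.2 (hM.sum_le_tsum _ fun j _ ↦ hM0' j)
    have hexpT : 0 < Real.exp T := Real.exp_pos T
    have hJ1 : (0 : ℝ) < J + 1 := by positivity
    calc Real.exp (∑ j ∈ Finset.range J, M j) * ∑ j ∈ Finset.range J, ‖g j x - u n j x‖
        ≤ Real.exp T * (J * (ε / (3 * Real.exp T * (J + 1)))) :=
          mul_le_mul hexp_le hsum_le (Finset.sum_nonneg fun _ _ ↦ norm_nonneg _) hexpT.le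
      _ = (ε / 3) * (J / (J + 1)) := by
          field_simp
      _ ≤ (ε / 3) * 1 := by
          refine mul_le_mul_of_nonneg_left ?_ (by positivity)
          rw [div_le_one hJ1]
          linarith
      _ = ε / 3 := mul_one _
  have hfin : ‖(∏' j, (1 + g j x) - ∏ j ∈ Finset.range J, (1 + g j x)) +
        (∏ j ∈ Finset.range J, (1 + g j x) - ∏ j ∈ Finset.range J, (1 + u n j x))‖ +
      ‖∏' j, (1 + u n j x) - ∏ j ∈ Finset.range J, (1 + u n j x)‖ < ε := by
    have h12 := norm_add_le (∏' j, (1 + g j x) - ∏ j ∈ Finset.range J, (1 + g j x))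
      (∏ j ∈ Finset.range J, (1 + g j x) - ∏ j ∈ Finset.range J, (1 + u n j x))
    linarith
  rw [dist_eq_norm]
  refine lt_of_le_of_lt ?_ hfin
  refine le_trans (le_of_eq ?_) (norm_sub_le _ _)
  congr 1
  ring

/-! ## §4 Per-index convergence (CR Lemma 3.4) from separation and pointwise vanishing -/

/-- Weierstrass' product inequality: `1 − Σ_s u_j ≤ ∏_s (1 − u_j)` for `0 ≤ u_j ≤ 1`.
[cite: CardonRoberts2006, Lemma 3.5 p. 62 (tail products)] -/
theorem one_sub_sum_le_prod_one_sub (s : Finset ℕ) (u : ℕ → ℝ) (h0 : ∀ j ∈ s, 0 ≤ u j)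
    (h1 : ∀ j ∈ s, u j ≤ 1) : 1 - ∑ j ∈ s, u j ≤ ∏ j ∈ s, (1 - u j) := by
  classical
  induction s using Finset.induction_on with
  | empty => simp
  | insert i s hi ih =>
    rw [Finset.sum_insert hi, Finset.prod_insert hi]
    have h0i := h0 i (Finset.mem_insert_self i s)
    have h1i := h1 i (Finset.mem_insert_self i s)
    have ih' := ih (fun j hj ↦ h0 j (Finset.mem_insert_of_mem hj))
      (fun j hj ↦ h1 j (Finset.mem_insert_of_mem hj))
    have hS : 0 ≤ ∑ j ∈ s, u j := Finset.sum_nonneg fun j hj ↦ h0 j (Finset.mem_insert_of_mem hj)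
    nlinarith [mul_le_mul_of_nonneg_left ih' (sub_nonneg.2 h1i), mul_nonneg h0i hS]

/-- **CR Lemma 3.4 on the tree's road: `x_{n,k} → a_k`.** Let `0 < a_0 < a_1 < ⋯` with
`Σ a_k⁻² < ∞`, and for each `n` let `x_{n,0}, …, x_{n,m_n−1}` be positive numbers with
`a_j < x_{n,j}` (CR Lemma 3.3) such that `∏_{j<m_n} (1 − a_k²/x_{n,j}²) → 0` for every `k` (on
the tree's road this comes from the `L²`-extremal property and polynomial density; in CR from the
determinacy of the moment problem). Then for every `k`, `x_{n,k} → a_k` — stated for the padded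
reciprocal squares `v_{n,k} = x_{n,k}⁻²` (`0` for `k ≥ m_n`): `v_{n,k} → a_k⁻²`. Proof by strong
induction: the factors `j < k` tend to the non-zero `1 − a_k²/a_j²`, the factors `j > k` have
product `≥ c₀ > 0` uniformly, so the factor `j = k` must tend to `0`.
[cite: CardonRoberts2006, Lemma 3.4 pp. 61–62] -/
theorem tendsto_inv_sq_of_separation (e : ℕ → ℝ) (he : StrictMono e) (he0 : 0 < e 0)
    (hsum : Summable fun k ↦ (e k ^ 2)⁻¹) (m : ℕ → ℕ) (x : ℕ → ℕ → ℝ)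
    (hsep : ∀ n j, j < m n → e j < x n j)
    (hpt : ∀ k, Tendsto (fun n ↦ ∏ j ∈ Finset.range (m n), (1 - e k ^ 2 / x n j ^ 2)) atTop (𝓝 0))
    (k : ℕ) :
    Tendsto (fun n ↦ if k < m n then (x n k ^ 2)⁻¹ else 0) atTop (𝓝 (e k ^ 2)⁻¹) := by
  have hepos : ∀ j, 0 < e j := fun j ↦ lt_of_lt_of_le he0 (he.monotone (Nat.zero_le j))
  induction k using Nat.strong_induction_on with
  | _ k ih =>
  -- padded reciprocal squares and their bounds
  set v : ℕ → ℕ → ℝ := fun n j ↦ if j < m n then (x n j ^ 2)⁻¹ else 0 with hv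
  have hv0 : ∀ n j, 0 ≤ v n j := by
    intro n j; simp only [hv]; split_ifs <;> positivity
  have hvle : ∀ n j, v n j ≤ (e j ^ 2)⁻¹ := by
    intro n j
    simp only [hv]
    split_ifs with h
    · have := hsep n j h
      have hx : 0 < x n j := (hepos j).trans this
      exact inv_anti₀ (pow_pos (hepos j) 2) (by nlinarith [hepos j])
    · exact (inv_pos.2 (pow_pos (hepos j) 2)).le
  -- factors `f n j = 1 − e_k² v_{n,j}`; for `j > k` they lie in `[q j, 1]`, `q j = 1 − e_k²/e_j²`
  set f : ℕ → ℕ → ℝ := fun n j ↦ 1 - e k ^ 2 * v n j with hf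
  set q : ℕ → ℝ := fun j ↦ 1 - e k ^ 2 * (e j ^ 2)⁻¹ with hq
  have hq_pos : ∀ j, k < j → 0 < q j := by
    intro j hj
    have hlt : e k < e j := he hj
    have : e k ^ 2 < e j ^ 2 := by nlinarith [hepos k, hepos j]
    simp only [hq]
    rw [← div_eq_mul_inv, sub_pos, div_lt_one (pow_pos (hepos j) 2)]
    exact this
  have hq_le_one : ∀ j, q j ≤ 1 := fun j ↦ by
    simp only [hq]; nlinarith [sq_nonneg (e k), inv_nonneg.2 (sq_nonneg (e j))]
  have hqf : ∀ n j, q j ≤ f n j := fun n j ↦ by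
    simp only [hq, hf]; nlinarith [hvle n j, sq_nonneg (e k)]
  have hf1 : ∀ n j, f n j ≤ 1 := fun n j ↦ by
    simp only [hf]; nlinarith [hv0 n j, sq_nonneg (e k)]
  -- the hypothesis, rewritten with the padded factors over any range containing `m n`
  have hprod_eq : ∀ n M, m n ≤ M → ∏ j ∈ Finset.range M, f n j =
      ∏ j ∈ Finset.range (m n), (1 - e k ^ 2 / x n j ^ 2) := by
    intro n M hM
    rw [← Finset.prod_subset (Finset.range_subset_range.2 hM) (fun j _ hj ↦ by
      have hj' : ¬ j < m n := by simpa using hj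
      simp [hf, hv, hj'])]
    refine Finset.prod_congr rfl fun j hj ↦ ?_
    have hj' : j < m n := Finset.mem_range.1 hj
    simp [hf, hv, hj', div_eq_mul_inv]
  -- choose `J` so that the tail `Σ_{j ≥ k+1+J} e_k²/e_j² ≤ 1/2`
  have htail : Tendsto (fun J ↦ ∑' i, e k ^ 2 * (e (i + (k + 1 + J)) ^ 2)⁻¹) atTop (𝓝 0) := by
    have h := tendsto_sum_nat_add fun j ↦ e k ^ 2 * (e j ^ 2)⁻¹
    have h2 : Tendsto (fun J : ℕ ↦ k + 1 + J) atTop atTop :=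
      Filter.tendsto_atTop_atTop.2 fun b ↦ ⟨b, fun J hJ ↦ by omega⟩
    exact h.comp h2
  obtain ⟨J, hJ⟩ := (htail.eventually (ge_mem_nhds (show (0 : ℝ) < 1 / 2 by norm_num))).exists
  have hsum' : Summable fun j ↦ e k ^ 2 * (e j ^ 2)⁻¹ := hsum.mul_left _
  -- the uniform lower bound `c₀` for the tail products
  set P0 : ℝ := ∏ j ∈ Finset.Ico (k + 1) (k + 1 + J), q j with hP0
  have hP0pos : 0 < P0 := Finset.prod_pos fun j hj ↦ hq_pos j (by
    have := (Finset.mem_Ico.1 hj).1; omega)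
  have hC : ∀ n M, k + 1 + J ≤ M → P0 * (1 / 2) ≤ ∏ j ∈ Finset.Ico (k + 1) M, f n j := by
    intro n M hM
    rw [← Finset.prod_Ico_consecutive _ (show k + 1 ≤ k + 1 + J by omega) hM]
    refine mul_le_mul ?_ ?_ (by norm_num) ?_
    · exact Finset.prod_le_prod (fun j hj ↦ (hq_pos j (by have := (Finset.mem_Ico.1 hj).1; omega)).le)
        fun j _ ↦ hqf n j
    · -- Weierstrass + tail bound
      have hW := one_sub_sum_le_prod_one_sub (Finset.Ico (k + 1 + J) M) (fun j ↦ e k ^ 2 * v n j)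
        (fun j _ ↦ by have := hv0 n j; positivity)
        (fun j hj ↦ by
          have h1 : e k ^ 2 * v n j ≤ e k ^ 2 * (e j ^ 2)⁻¹ :=
            mul_le_mul_of_nonneg_left (hvle n j) (sq_nonneg _)
          have h2 := hq_pos j (by have := (Finset.mem_Ico.1 hj).1; omega)
          simp only [hq] at h2
          linarith)
      have htail_le : ∑ j ∈ Finset.Ico (k + 1 + J) M, e k ^ 2 * v n j ≤ 1 / 2 := by
        calc ∑ j ∈ Finset.Ico (k + 1 + J) M, e k ^ 2 * v n j
            ≤ ∑ j ∈ Finset.Ico (k + 1 + J) M, e k ^ 2 * (e j ^ 2)⁻¹ :=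
              Finset.sum_le_sum fun j _ ↦ mul_le_mul_of_nonneg_left (hvle n j) (sq_nonneg _)
          _ ≤ ∑' i, e k ^ 2 * (e (i + (k + 1 + J)) ^ 2)⁻¹ := by
              have hs := (summable_nat_add_iff (k + 1 + J)).2 hsum'
              have hinj : ∀ j ∈ Finset.Ico (k + 1 + J) M,
                  e k ^ 2 * (e j ^ 2)⁻¹ = (fun i ↦ e k ^ 2 * (e (i + (k + 1 + J)) ^ 2)⁻¹) (j - (k + 1 + J)) := by
                intro j hj
                have := (Finset.mem_Ico.1 hj).1
                simp only [Nat.sub_add_cancel this]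
              rw [Finset.sum_congr rfl hinj, ← Finset.sum_image (s := Finset.Ico (k + 1 + J) M)
                (g := fun j ↦ j - (k + 1 + J)) (f := fun i ↦ e k ^ 2 * (e (i + (k + 1 + J)) ^ 2)⁻¹) ?_]
              · exact hs.sum_le_tsum _ fun i _ ↦ by positivity
              · intro a ha b hb hab
                have ha' := (Finset.mem_Ico.1 ha).1
                have hb' := (Finset.mem_Ico.1 hb).1
                simp only at hab
                omega
          _ ≤ 1 / 2 := hJ
      have : (fun j ↦ 1 - e k ^ 2 * v n j) = f n := by funext j; simp [hf]
      rw [this] at hW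
      linarith
    · exact Finset.prod_nonneg fun j hj ↦
        (hq_pos j (by have := (Finset.mem_Ico.1 hj).1; omega)).le.trans (hqf n j)
  -- the head products converge to a non-zero limit (induction hypothesis)
  set A : ℝ := ∏ j ∈ Finset.range k, q j with hA
  have hA_ne : A ≠ 0 := by
    refine Finset.prod_ne_zero_iff.2 fun j hj ↦ ?_
    have hjk : j < k := Finset.mem_range.1 hj
    have hlt : e j < e k := he hjk
    have hlt2 : e j ^ 2 < e k ^ 2 := by nlinarith [hepos k, hepos j]
    simp only [hq]
    rw [← div_eq_mul_inv, sub_ne_zero, ne_comm, ne_eq, div_eq_one_iff_eq (pow_pos (hepos j) 2).ne']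
    exact hlt2.ne'
  have hA_lim : Tendsto (fun n ↦ ∏ j ∈ Finset.range k, f n j) atTop (𝓝 A) := by
    refine tendsto_finsetProd _ fun j hj ↦ ?_
    have hjk : j < k := Finset.mem_range.1 hj
    have h := (ih j hjk).const_mul (e k ^ 2)
    simpa [hf, hq, hv] using h.const_sub 1
  -- decomposition `∏_{j<M} f = (∏_{j<k} f) · f k · ∏_{k<j<M} f` for `M n = max (m n) (k+1+J)`
  have hdecomp : ∀ n, ∏ j ∈ Finset.range (m n), (1 - e k ^ 2 / x n j ^ 2) =
      (∏ j ∈ Finset.range k, f n j) * f n k *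
        ∏ j ∈ Finset.Ico (k + 1) (max (m n) (k + 1 + J)), f n j := by
    intro n
    rw [← hprod_eq n (max (m n) (k + 1 + J)) (le_max_left _ _), Finset.range_eq_Ico,
      ← Finset.prod_Ico_consecutive _ (Nat.zero_le k) (show k ≤ max (m n) (k + 1 + J) by omega),
      Finset.prod_eq_prod_Ico_succ_bot (show k < max (m n) (k + 1 + J) by omega), ← Finset.range_eq_Ico]
    ring
  -- conclusion: `f n k → 0`
  have hfk : Tendsto (fun n ↦ f n k) atTop (𝓝 0) := by
    have hAn : ∀ᶠ n in atTop, ‖A‖ / 2 < ‖∏ j ∈ Finset.range k, f n j‖ :=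
      hA_lim.norm.eventually_const_lt (by simpa using (norm_pos_iff.2 hA_ne))
    have hc0 : 0 < ‖A‖ / 2 * (P0 * (1 / 2)) := by positivity
    refine squeeze_zero_norm' (a := fun n ↦ ‖∏ j ∈ Finset.range (m n), (1 - e k ^ 2 / x n j ^ 2)‖ /
      (‖A‖ / 2 * (P0 * (1 / 2)))) ?_ ?_
    · filter_upwards [hAn] with n hn
      rw [le_div_iff₀ hc0, hdecomp n, norm_mul, norm_mul]
      have hCn := hC n (max (m n) (k + 1 + J)) (le_max_right _ _)
      have hCn' : P0 * (1 / 2) ≤ ‖∏ j ∈ Finset.Ico (k + 1) (max (m n) (k + 1 + J)), f n j‖ :=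
        hCn.trans (Real.le_norm_self _)
      have h1 : ‖f n k‖ * (‖A‖ / 2 * (P0 * (1 / 2))) ≤
          ‖f n k‖ * (‖∏ j ∈ Finset.range k, f n j‖ *
            ‖∏ j ∈ Finset.Ico (k + 1) (max (m n) (k + 1 + J)), f n j‖) := by
        refine mul_le_mul_of_nonneg_left ?_ (norm_nonneg _)
        exact mul_le_mul hn.le hCn' (by positivity) (norm_nonneg _)
      linarith
    · have h := (hpt k).norm.div_const (‖A‖ / 2 * (P0 * (1 / 2)))
      rw [norm_zero, zero_div] at h
      exact h
  -- `v n k = (1 − f n k)/e_k² → 1/e_k²`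
  have hvk : Tendsto (fun n ↦ v n k) atTop (𝓝 (e k ^ 2)⁻¹) := by
    have h := (hfk.const_sub 1).div_const (e k ^ 2)
    rw [sub_zero, one_div] at h
    refine h.congr fun n ↦ ?_
    have hek : e k ^ 2 ≠ 0 := (pow_pos (hepos k) 2).ne'
    simp only [hf, sub_sub_cancel]
    exact mul_div_cancel_left₀ _ hek
  simpa [hv] using hvk

/-! ## §5 Locally uniform convergence of the products (CR Lemma 3.5, abstract indexed form) -/

/-- **CR Lemma 3.5, indexed form.** Under the hypotheses of `tendsto_inv_sq_of_separation`,
`∏_{j<m_n} (1 − z²/x_{n,j}²) → ∏_k (1 − z²/a_k²)` uniformly on compact subsets of `ℂ`: on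
`|z| ≤ R` the factors are dominated by `1 + R²/a_k²` (since `a_k < x_{n,k}`), `Σ a_k⁻² < ∞`, and
each factor converges, so dominated convergence for products applies ("Since `M_R` bounds all of
these products … the convergence is uniform on compact sets").
[cite: CardonRoberts2006, Lemma 3.5 pp. 62–63] -/
theorem tendstoLocallyUniformly_prod_range (e : ℕ → ℝ) (he : StrictMono e) (he0 : 0 < e 0)
    (hsum : Summable fun k ↦ (e k ^ 2)⁻¹) (m : ℕ → ℕ) (x : ℕ → ℕ → ℝ)
    (hsep : ∀ n j, j < m n → e j < x n j)
    (hpt : ∀ k, Tendsto (fun n ↦ ∏ j ∈ Finset.range (m n), (1 - e k ^ 2 / x n j ^ 2)) atTop (𝓝 0)) :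
    TendstoLocallyUniformly
      (fun n (z : ℂ) ↦ ∏ j ∈ Finset.range (m n), (1 - z ^ 2 / (x n j : ℂ) ^ 2))
      (fun z ↦ ∏' k, (1 - z ^ 2 / (e k : ℂ) ^ 2)) atTop := by
  have hepos : ∀ j, 0 < e j := fun j ↦ lt_of_lt_of_le he0 (he.monotone (Nat.zero_le j))
  -- padded reciprocal squares
  set v : ℕ → ℕ → ℝ := fun n j ↦ if j < m n then (x n j ^ 2)⁻¹ else 0 with hv
  have hv0 : ∀ n j, 0 ≤ v n j := by
    intro n j; simp only [hv]; split_ifs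
    · positivity
    · exact le_rfl
  have hvle : ∀ n j, v n j ≤ (e j ^ 2)⁻¹ := by
    intro n j
    simp only [hv]
    split_ifs with h
    · have := hsep n j h
      have hx : 0 < x n j := (hepos j).trans this
      exact inv_anti₀ (pow_pos (hepos j) 2) (by nlinarith [hepos j])
    · exact (inv_pos.2 (pow_pos (hepos j) 2)).le
  have hvlim : ∀ j, Tendsto (fun n ↦ v n j) atTop (𝓝 (e j ^ 2)⁻¹) := fun j ↦ by
    simpa [hv] using tendsto_inv_sq_of_separation e he he0 hsum m x hsep hpt j
  rw [tendstoLocallyUniformly_iff_forall_isCompact]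
  intro K hK
  obtain ⟨R, hR⟩ := hK.isBounded.subset_closedBall 0
  have hzR : ∀ z ∈ K, ‖z‖ ^ 2 ≤ R ^ 2 := fun z hz ↦ by
    have h := hR hz
    rw [Metric.mem_closedBall, dist_zero_right] at h
    exact pow_le_pow_left₀ (norm_nonneg _) h 2
  -- the dominated system
  set u : ℕ → ℕ → ℂ → ℂ := fun n j z ↦ -(z ^ 2 * ((v n j : ℝ) : ℂ)) with hu
  set g : ℕ → ℂ → ℂ := fun j z ↦ -(z ^ 2 * (((e j ^ 2)⁻¹ : ℝ) : ℂ)) with hg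
  set M : ℕ → ℝ := fun j ↦ R ^ 2 * (e j ^ 2)⁻¹ with hM
  have hMs : Summable M := hsum.mul_left _
  have hu_bd : ∀ n j z, z ∈ K → ‖u n j z‖ ≤ M j := by
    intro n j z hz
    simp only [hu, hM, norm_neg, norm_mul, norm_pow, Complex.norm_real, Real.norm_eq_abs,
      abs_of_nonneg (hv0 n j)]
    exact mul_le_mul (hzR z hz) (hvle n j) (hv0 n j) (sq_nonneg _)
  have hg_bd : ∀ j z, z ∈ K → ‖g j z‖ ≤ M j := by
    intro j z hz
    simp only [hg, hM, norm_neg, norm_mul, norm_pow, Complex.norm_real, Real.norm_eq_abs,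
      abs_of_nonneg (inv_pos.2 (pow_pos (hepos j) 2)).le]
    exact mul_le_mul_of_nonneg_right (hzR z hz) (inv_pos.2 (pow_pos (hepos j) 2)).le
  have hlim : ∀ j, TendstoUniformlyOn (fun n ↦ u n j) (g j) atTop K := by
    intro j
    rw [Metric.tendstoUniformlyOn_iff]
    intro ε hε
    have h := hvlim j
    rw [Metric.tendsto_nhds] at h
    filter_upwards [h (ε / (R ^ 2 + 1)) (by positivity)] with n hn z hz
    have hdiff : g j z - u n j z = z ^ 2 * (((v n j - (e j ^ 2)⁻¹ : ℝ)) : ℂ) := by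
      simp only [hu, hg]
      push_cast
      ring
    rw [dist_eq_norm, hdiff, norm_mul, norm_pow, Complex.norm_real, Real.norm_eq_abs,
      ← Real.dist_eq]
    calc ‖z‖ ^ 2 * dist (v n j) (e j ^ 2)⁻¹ ≤ R ^ 2 * (ε / (R ^ 2 + 1)) :=
          mul_le_mul (hzR z hz) hn.le dist_nonneg (sq_nonneg _)
      _ < ε := by
          rw [← mul_div_assoc, div_lt_iff₀ (by positivity)]
          nlinarith
  have key := tendstoUniformlyOn_tprod_one_add hMs hu_bd hg_bd hlim
  refine (key.congr ?_).congr_right ?_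
  · refine Filter.Eventually.of_forall fun n z _ ↦ ?_
    simp only
    rw [tprod_eq_prod (s := Finset.range (m n)) (fun j hj ↦ ?_)]
    · refine Finset.prod_congr rfl fun j hj ↦ ?_
      have hj' : j < m n := Finset.mem_range.1 hj
      have hx : (x n j : ℂ) ≠ 0 := by exact_mod_cast ((hepos j).trans (hsep n j hj')).ne'
      simp only [hu, hv, hj', if_true]
      push_cast
      field_simp
      ring
    · have hj' : ¬ j < m n := by simpa using hj
      simp [hu, hv, hj']
  · intro z _
    simp only [hg]
    refine tprod_congr fun k ↦ ?_
    have hek : (e k : ℂ) ≠ 0 := by exact_mod_cast (hepos k).ne'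
    push_cast
    field_simp
    ring

/-! ## §6 The set form used for `CardonRoberts2006_lemma_3_5` -/

/-- Products over a finite set of reals, re-indexed increasingly by `Finset.orderEmbOfFin`.
[cite: CardonRoberts2006, §3 p. 61 (labelling `x_{n,1} < x_{n,2} < ⋯`)] -/
theorem prod_eq_prod_range_orderEmb {β : Type*} [CommMonoid β] (Z : Finset ℝ) (F : ℝ → β) :
    ∏ y ∈ Z, F y = ∏ j ∈ Finset.range Z.card,
      F (if h : j < Z.card then Z.orderEmbOfFin rfl ⟨j, h⟩ else 0) := by
  classical
  rw [Finset.prod_range]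
  have himage : (Finset.univ : Finset (Fin Z.card)).image (Z.orderEmbOfFin rfl) = Z := by
    apply Finset.coe_injective
    rw [Finset.coe_image, Finset.coe_univ, Set.image_univ, Finset.range_orderEmbOfFin]
  conv_lhs => rw [← himage]
  rw [Finset.prod_image fun a _ b _ hab ↦ (Z.orderEmbOfFin rfl).injective hab]
  refine Finset.prod_congr rfl fun i _ ↦ ?_
  simp [i.2]

/-- The `i`-th point of the increasing labelling of a finite set of reals has exactly `i + 1`
points of the set below or at it. [cite: CardonRoberts2006, §3 p. 61 (labelling `x_{n,1} < x_{n,2} < ⋯`)] -/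
theorem card_filter_le_orderEmb (Z : Finset ℝ) (i : Fin Z.card) :
    (Z.filter (· ≤ Z.orderEmbOfFin rfl i)).card = i + 1 := by
  classical
  set φ := Z.orderEmbOfFin rfl with hφ
  have hset : Z.filter (· ≤ φ i) = (Finset.Iic i).image φ := by
    ext y
    simp only [Finset.mem_filter, Finset.mem_image, Finset.mem_Iic]
    constructor
    · rintro ⟨hy, hyi⟩
      have hy' : y ∈ Set.range φ := by rw [hφ, Finset.range_orderEmbOfFin]; exact hy
      obtain ⟨j, rfl⟩ := hy'
      exact ⟨j, φ.le_iff_le.1 hyi, rfl⟩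
    · rintro ⟨j, hj, rfl⟩
      exact ⟨by rw [hφ]; exact Finset.orderEmbOfFin_mem _ _ _, φ.le_iff_le.2 hj⟩
  rw [hset, Finset.card_image_of_injective _ φ.injective, Fin.card_Iic]

/-- **CR Lemma 3.5, set form (RH-FREE abstract convergence theorem).** Let `S ⊂ (0,∞)` be
infinite with finite lower sections and `Σ_{a∈S} a⁻² < ∞`, and let `Z_n` be finite sets of
reals such that (separation, CR Lemma 3.3 in counting form) `#{x ∈ Z_n : x ≤ t} ≤ #(F ∩ [0,t))`
for every finite `F ⊇ S ∩ (−∞,t)`, and (vanishing at the spectrum) `∏_{x∈Z_n}(1 − a²/x²) → 0`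
for every `a ∈ S`. Then `∏_{x ∈ Z_n} (1 − z²/x²) → ∏_{a ∈ S} (1 − z²/a²)` locally uniformly on
`ℂ`. [cite: CardonRoberts2006, Lemmas 3.3–3.5 pp. 61–63] -/
theorem tendstoLocallyUniformly_prod {S : Set ℝ} (hSpos : ∀ a ∈ S, 0 < a) (hSinf : S.Infinite)
    (hSfin : ∀ L : ℝ, (S ∩ Set.Iic L).Finite) (hSsum : Summable fun a : S ↦ ((a : ℝ) ^ 2)⁻¹)
    (Z : ℕ → Finset ℝ)
    (hsep : ∀ n (t : ℝ) (F : Finset ℝ), (∀ a ∈ S, a < t → a ∈ F) →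
      ((Z n).filter (· ≤ t)).card ≤ (F.filter (fun a ↦ 0 ≤ a ∧ a < t)).card)
    (hpt : ∀ a ∈ S, Tendsto (fun n ↦ ∏ x ∈ Z n, (1 - a ^ 2 / x ^ 2)) atTop (𝓝 0)) :
    TendstoLocallyUniformly (fun n (z : ℂ) ↦ ∏ x ∈ Z n, (1 - z ^ 2 / (x : ℂ) ^ 2))
      (fun z ↦ ∏' a : S, (1 - z ^ 2 / ((a : ℝ) : ℂ) ^ 2)) atTop := by
  classical
  obtain ⟨e, he, hrange⟩ := exists_strictMono_range_eq hSinf hSfin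
  have hmemS : ∀ k, e k ∈ S := fun k ↦ hrange ▸ Set.mem_range_self k
  have he0 : 0 < e 0 := hSpos _ (hmemS 0)
  have hsurj : ∀ a ∈ S, ∃ k, e k = a := fun a ha ↦ by
    have : a ∈ Set.range e := hrange.symm ▸ ha
    exact this
  set σ : ℕ ≃ S := Equiv.ofBijective (fun k ↦ ⟨e k, hmemS k⟩)
    ⟨fun a b h ↦ he.injective (congrArg Subtype.val h), fun a ↦ by
      obtain ⟨k, hk⟩ := hsurj a.1 a.2
      exact ⟨k, Subtype.ext hk⟩⟩ with hσ
  have hsum_e : Summable fun k ↦ (e k ^ 2)⁻¹ :=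
    (σ.summable_iff (f := fun a : S ↦ ((a : ℝ) ^ 2)⁻¹)).2 hSsum
  -- increasing labelling of `Z n`
  set m : ℕ → ℕ := fun n ↦ (Z n).card with hm
  set x : ℕ → ℕ → ℝ := fun n j ↦
    if h : j < (Z n).card then (Z n).orderEmbOfFin rfl ⟨j, h⟩ else 0 with hx
  -- separation in index form: `a_j < x_{n,j}`
  have hsep' : ∀ n j, j < m n → e j < x n j := by
    intro n j hj
    have hxj : x n j = (Z n).orderEmbOfFin rfl ⟨j, hj⟩ := by
      simp only [hx]
      rw [dif_pos (show j < (Z n).card from hj)]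
    set y := x n j with hy
    have hcount : ((Z n).filter (· ≤ y)).card = j + 1 := by
      rw [hxj]; exact card_filter_le_orderEmb (Z n) ⟨j, hj⟩
    -- an index `N` with `y ≤ e N`
    obtain ⟨N, hN⟩ : ∃ N, y ≤ e N := by
      by_contra h
      push Not at h
      refine Set.infinite_range_of_injective he.injective ((hSfin y).subset ?_)
      rintro _ ⟨i, rfl⟩
      exact ⟨hmemS i, (h i).le⟩
    set F : Finset ℝ := (Finset.range (N + 1)).image e with hF
    have hFS : ∀ a ∈ S, a < y → a ∈ F := by
      intro a ha hay
      obtain ⟨i, rfl⟩ := hsurj a ha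
      have hi : i < N := he.lt_iff_lt.1 (lt_of_lt_of_le hay hN)
      exact Finset.mem_image.2 ⟨i, Finset.mem_range.2 (by omega), rfl⟩
    have h1 := hsep n y F hFS
    rw [hcount] at h1
    by_contra hcon
    push Not at hcon
    have h2 : (F.filter (fun a ↦ 0 ≤ a ∧ a < y)).card ≤ j := by
      calc (F.filter (fun a ↦ 0 ≤ a ∧ a < y)).card
          ≤ (((Finset.range (N + 1)).filter (fun i ↦ e i < y)).image e).card := by
            refine Finset.card_le_card fun a ha ↦ ?_
            rw [Finset.mem_filter] at ha
            obtain ⟨i, hi, rfl⟩ := Finset.mem_image.1 ha.1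
            exact Finset.mem_image.2 ⟨i, Finset.mem_filter.2 ⟨hi, ha.2.2⟩, rfl⟩
        _ ≤ ((Finset.range (N + 1)).filter (fun i ↦ e i < y)).card := Finset.card_image_le
        _ ≤ (Finset.range j).card := by
            refine Finset.card_le_card fun i hi ↦ ?_
            rw [Finset.mem_filter] at hi
            exact Finset.mem_range.2 (he.lt_iff_lt.1 (lt_of_lt_of_le hi.2 hcon))
        _ = j := Finset.card_range j
    omega
  have hpt' : ∀ k, Tendsto (fun n ↦ ∏ j ∈ Finset.range (m n), (1 - e k ^ 2 / x n j ^ 2))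
      atTop (𝓝 0) := fun k ↦
    (hpt (e k) (hmemS k)).congr fun n ↦ prod_eq_prod_range_orderEmb (Z n) fun y ↦ 1 - e k ^ 2 / y ^ 2
  have H := tendstoLocallyUniformly_prod_range e he he0 hsum_e m x hsep' hpt'
  have hFun : (fun n (z : ℂ) ↦ ∏ y ∈ Z n, (1 - z ^ 2 / (y : ℂ) ^ 2)) =
      fun n z ↦ ∏ j ∈ Finset.range (m n), (1 - z ^ 2 / (x n j : ℂ) ^ 2) := by
    funext n z
    exact prod_eq_prod_range_orderEmb (Z n) fun y : ℝ ↦ 1 - z ^ 2 / (y : ℂ) ^ 2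
  have hLim : (fun z : ℂ ↦ ∏' a : S, (1 - z ^ 2 / ((a : ℝ) : ℂ) ^ 2)) =
      fun z ↦ ∏' k, (1 - z ^ 2 / (e k : ℂ) ^ 2) := by
    funext z
    exact (Equiv.tprod_eq σ fun a : S ↦ 1 - z ^ 2 / ((a : ℝ) : ℂ) ^ 2).symm
  rw [hFun, hLim]
  exact H

end CardonRobertsLimit

end Literature.NumberTheory.LFunctions

end
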